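/-
Width seat `ym-line-sgb-p1-w3` (gen 2, seat prover-ym-line-sgb-p1-w3-g2-0), route `SteinGapBootstrap`, crux U `FreeProbeLawG`
(stmt-QuantumFields-23756), line `birth` (lead ym-line-sgb-k1-g1) — helper A2a requested by the lead (`Lines/birth_A2a.lean`), statements verbatim.
-/
import Mathlib
import HarnessLib

/-!
# Crux U `FreeProbeLawG` (stmt-QuantumFields-23756), line `birth` — assembly part A2a (derivatives): calculus of the two weight test functions

NOT THE CLAY GAP: route `SteinGapBootstrap` serves the RECORD-label rung R2ξ-G (`WeakCouplingRates.XiPow`, an UPPER bound on the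
lattice gap); this file is pure finite-dimensional calculus and bears on no summit statement.

Setting (the lead's spec `Cruxes/FreeProbeLawG/Lines/birth_A2a.lean`, statements kept VERBATIM): on `ι → Fin D → ℝ` with the sup norm,
coefficients `c : ι → ℝ`, base index `p₀`, colour `a`, `δ > 0`; `z_b(y) = Σ_q c_q y_q^b`, `x_b(y) = y_{p₀}^b − z_b(y)`,
`W(y) = exp(−(δ/2) Σ_b (x_b² + z_b²))`, `gZ = z_a W`, `gX = x_a W`, `vec_q^b = [b = a] c_q`.
This module: the explicit Fréchet derivatives (`D z_b = Σ_q c_q π_{qb}`, `D x_b = π_{p₀b} − D z_b`, `DQ`, `D W = −(δ/2) W DQ`,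
`D gZ = z_a DW + W Dz_a`, `D gX = x_a DW + W Dx_a`), their values along `vec` (`D z_b[vec] = [b=a] Σc²`), and the scalar inequalities
`|u| e^{-δu²/2} ≤ δ^{-1/2}`, `u e^{-u/2} ≤ 1`, `|Σ c_q v_q^b| ≤ S‖v‖`, `S = Σ|c_q|`, and the core weight estimate
`δ e^{-δQ/2} |t| Σ_b(|x_b|+|z_b|) ≤ D + ½` (`t² ≤ Q`).  The lead's eight lemmas are in `…FreeProbeLawGTestFun`.

References: E. Meckes, IMS Coll. 5 (2009) 153, §1 (smooth test functions for Stein's method) [Meckes2009]; S. Chatterjee,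
arXiv:1602.01222 §11 [arXiv160201222].
-/

set_option autoImplicit false

noncomputable section

open Real Finset

namespace Summit.QuantumFields.YangMills.Cruxes.FreeProbeLawG.SteinFree

namespace TestFun

variable {ι : Type*} [Fintype ι] {D : ℕ} (c : ι → ℝ) (p₀ : ι) (δ : ℝ) (a : Fin D)

/-! ### The linear statistics `z_b`, `x_b` as continuous linear functionals -/

/-- The coordinate functional `y ↦ y q b` (sup norm): `|y q b| ≤ ‖y‖`. [folklore] -/
theorem abs_apply_apply_le (y : ι → Fin D → ℝ) (q : ι) (b : Fin D) : |y q b| ≤ ‖y‖ :=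
  (Real.norm_eq_abs _).symm.le.trans ((norm_le_pi_norm (y q) b).trans (norm_le_pi_norm y q))

/-- `z_b` is the continuous linear functional `Σ_q c_q π_{qb}`. [folklore] -/
theorem hasFDerivAt_z (b : Fin D) (y : ι → Fin D → ℝ) :
    HasFDerivAt (fun y : ι → Fin D → ℝ => ∑ q, c q * y q b)
      (∑ q, c q • ((ContinuousLinearMap.proj (R := ℝ) b).comp
        (ContinuousLinearMap.proj (R := ℝ) (φ := fun _ : ι => Fin D → ℝ) q))) y := by
  have h : (fun y : ι → Fin D → ℝ => ∑ q, c q * y q b) =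
      ⇑(∑ q, c q • ((ContinuousLinearMap.proj (R := ℝ) b).comp
        (ContinuousLinearMap.proj (R := ℝ) (φ := fun _ : ι => Fin D → ℝ) q))) := by
    funext y; simp
  rw [h]
  exact ContinuousLinearMap.hasFDerivAt _

/-- `x_b = π_{p₀ b} − z_b`. [folklore] -/
theorem hasFDerivAt_x (b : Fin D) (y : ι → Fin D → ℝ) :
    HasFDerivAt (fun y : ι → Fin D → ℝ => y p₀ b - ∑ q, c q * y q b)
      (((ContinuousLinearMap.proj (R := ℝ) b).comp (ContinuousLinearMap.proj (R := ℝ) (φ := fun _ : ι => Fin D → ℝ) p₀)) -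
        ∑ q, c q • ((ContinuousLinearMap.proj (R := ℝ) b).comp
          (ContinuousLinearMap.proj (R := ℝ) (φ := fun _ : ι => Fin D → ℝ) q))) y :=
  (((ContinuousLinearMap.proj (R := ℝ) b).comp
    (ContinuousLinearMap.proj (R := ℝ) (φ := fun _ : ι => Fin D → ℝ) p₀)).hasFDerivAt).sub (hasFDerivAt_z c b y)

/-- The quadratic form `Q = Σ_b (x_b² + z_b²)` and its derivative `DQ = Σ_b (2x_b Dx_b + 2z_b Dz_b)`. [folklore] -/
theorem hasFDerivAt_Q (y : ι → Fin D → ℝ) :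
    HasFDerivAt (fun y : ι → Fin D → ℝ => ∑ b, ((y p₀ b - ∑ q, c q * y q b) ^ 2 + (∑ q, c q * y q b) ^ 2))
      (∑ b, ((2 * (y p₀ b - ∑ q, c q * y q b)) •
          (((ContinuousLinearMap.proj (R := ℝ) b).comp (ContinuousLinearMap.proj (R := ℝ) (φ := fun _ : ι => Fin D → ℝ) p₀)) -
            ∑ q, c q • ((ContinuousLinearMap.proj (R := ℝ) b).comp
              (ContinuousLinearMap.proj (R := ℝ) (φ := fun _ : ι => Fin D → ℝ) q))) +
        (2 * ∑ q, c q * y q b) •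
          ∑ q, c q • ((ContinuousLinearMap.proj (R := ℝ) b).comp
            (ContinuousLinearMap.proj (R := ℝ) (φ := fun _ : ι => Fin D → ℝ) q)))) y := by
  refine HasFDerivAt.fun_sum fun b _ => ?_
  have h1 := (hasFDerivAt_x c p₀ b y).pow 2
  have h2 := (hasFDerivAt_z c b y).pow 2
  have h := h1.add h2
  refine h.congr_fderiv ?_
  norm_num

/-- The weight `W = exp(−(δ/2) Q)` and its derivative `DW = W · (−(δ/2)) DQ`. [folklore] -/
theorem hasFDerivAt_W (y : ι → Fin D → ℝ) :
    HasFDerivAt (fun y : ι → Fin D → ℝ => Real.exp (-(δ / 2) * ∑ b, ((y p₀ b - ∑ q, c q * y q b) ^ 2 + (∑ q, c q * y q b) ^ 2)))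
      (Real.exp (-(δ / 2) * ∑ b, ((y p₀ b - ∑ q, c q * y q b) ^ 2 + (∑ q, c q * y q b) ^ 2)) •
        ((-(δ / 2)) • ∑ b, ((2 * (y p₀ b - ∑ q, c q * y q b)) •
          (((ContinuousLinearMap.proj (R := ℝ) b).comp (ContinuousLinearMap.proj (R := ℝ) (φ := fun _ : ι => Fin D → ℝ) p₀)) -
            ∑ q, c q • ((ContinuousLinearMap.proj (R := ℝ) b).comp
              (ContinuousLinearMap.proj (R := ℝ) (φ := fun _ : ι => Fin D → ℝ) q))) +
        (2 * ∑ q, c q * y q b) •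
          ∑ q, c q • ((ContinuousLinearMap.proj (R := ℝ) b).comp
            (ContinuousLinearMap.proj (R := ℝ) (φ := fun _ : ι => Fin D → ℝ) q))))) y :=
  ((hasFDerivAt_Q c p₀ y).const_mul (-(δ / 2))).exp

/-- `D gZ = z_a • DW + W • Dz_a`. [folklore] -/
theorem hasFDerivAt_gZ (y : ι → Fin D → ℝ) :
    HasFDerivAt (fun y : ι → Fin D → ℝ => (∑ q, c q * y q a) *
      Real.exp (-(δ / 2) * ∑ b, ((y p₀ b - ∑ q, c q * y q b) ^ 2 + (∑ q, c q * y q b) ^ 2)))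
      ((∑ q, c q * y q a) • (Real.exp (-(δ / 2) * ∑ b, ((y p₀ b - ∑ q, c q * y q b) ^ 2 + (∑ q, c q * y q b) ^ 2)) •
        ((-(δ / 2)) • ∑ b, ((2 * (y p₀ b - ∑ q, c q * y q b)) •
          (((ContinuousLinearMap.proj (R := ℝ) b).comp (ContinuousLinearMap.proj (R := ℝ) (φ := fun _ : ι => Fin D → ℝ) p₀)) -
            ∑ q, c q • ((ContinuousLinearMap.proj (R := ℝ) b).comp
              (ContinuousLinearMap.proj (R := ℝ) (φ := fun _ : ι => Fin D → ℝ) q))) +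
        (2 * ∑ q, c q * y q b) •
          ∑ q, c q • ((ContinuousLinearMap.proj (R := ℝ) b).comp
            (ContinuousLinearMap.proj (R := ℝ) (φ := fun _ : ι => Fin D → ℝ) q))))) +
        Real.exp (-(δ / 2) * ∑ b, ((y p₀ b - ∑ q, c q * y q b) ^ 2 + (∑ q, c q * y q b) ^ 2)) •
          ∑ q, c q • ((ContinuousLinearMap.proj (R := ℝ) a).comp
            (ContinuousLinearMap.proj (R := ℝ) (φ := fun _ : ι => Fin D → ℝ) q))) y :=
  (hasFDerivAt_z c a y).mul (hasFDerivAt_W c p₀ δ y)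

/-- `D gX = x_a • DW + W • Dx_a`. [folklore] -/
theorem hasFDerivAt_gX (y : ι → Fin D → ℝ) :
    HasFDerivAt (fun y : ι → Fin D → ℝ => (y p₀ a - ∑ q, c q * y q a) *
      Real.exp (-(δ / 2) * ∑ b, ((y p₀ b - ∑ q, c q * y q b) ^ 2 + (∑ q, c q * y q b) ^ 2)))
      ((y p₀ a - ∑ q, c q * y q a) • (Real.exp (-(δ / 2) * ∑ b, ((y p₀ b - ∑ q, c q * y q b) ^ 2 + (∑ q, c q * y q b) ^ 2)) •
        ((-(δ / 2)) • ∑ b, ((2 * (y p₀ b - ∑ q, c q * y q b)) •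
          (((ContinuousLinearMap.proj (R := ℝ) b).comp (ContinuousLinearMap.proj (R := ℝ) (φ := fun _ : ι => Fin D → ℝ) p₀)) -
            ∑ q, c q • ((ContinuousLinearMap.proj (R := ℝ) b).comp
              (ContinuousLinearMap.proj (R := ℝ) (φ := fun _ : ι => Fin D → ℝ) q))) +
        (2 * ∑ q, c q * y q b) •
          ∑ q, c q • ((ContinuousLinearMap.proj (R := ℝ) b).comp
            (ContinuousLinearMap.proj (R := ℝ) (φ := fun _ : ι => Fin D → ℝ) q))))) +
        Real.exp (-(δ / 2) * ∑ b, ((y p₀ b - ∑ q, c q * y q b) ^ 2 + (∑ q, c q * y q b) ^ 2)) •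
          (((ContinuousLinearMap.proj (R := ℝ) a).comp (ContinuousLinearMap.proj (R := ℝ) (φ := fun _ : ι => Fin D → ℝ) p₀)) -
            ∑ q, c q • ((ContinuousLinearMap.proj (R := ℝ) a).comp
              (ContinuousLinearMap.proj (R := ℝ) (φ := fun _ : ι => Fin D → ℝ) q)))) y :=
  (hasFDerivAt_x c p₀ a y).mul (hasFDerivAt_W c p₀ δ y)

/-! ### Evaluation along `vec` -/

/-- `Dz_b[vec] = [b = a] Σ_q c_q²`. [folklore] -/
theorem z_vec (b : Fin D) :
    (∑ q, c q • ((ContinuousLinearMap.proj (R := ℝ) b).comp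
        (ContinuousLinearMap.proj (R := ℝ) (φ := fun _ : ι => Fin D → ℝ) q)))
      (fun q b' => if b' = a then c q else 0) = if b = a then ∑ q, c q ^ 2 else 0 := by
  split_ifs with h
  · simp [h, pow_two]
  · simp [h]

omit [Fintype ι] in
/-- `π_{p₀ b}[vec] = [b = a] c_{p₀}`. [folklore] -/
theorem proj_vec (b : Fin D) :
    ((ContinuousLinearMap.proj (R := ℝ) b).comp (ContinuousLinearMap.proj (R := ℝ) (φ := fun _ : ι => Fin D → ℝ) p₀))
      (fun q b' => if b' = a then c q else 0) = if b = a then c p₀ else 0 := by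
  simp


/-- Distributed form of `Dz_b[vec]`: `Σ_q c_q vec_q^b = [b = a] Σ_q c_q²`. [folklore] -/
theorem sum_mul_vec (b : Fin D) :
    ∑ q, c q * (if b = a then c q else 0) = if b = a then ∑ q, c q ^ 2 else 0 := by
  split_ifs with h
  · simp [pow_two]
  · simp

/-! ### Scalar inequalities -/

/-- `|u| · e^{−(δ/2) u²} ≤ δ^{−1/2}` for `δ > 0` (from `s e^{−s} ≤ 1`, `s = δu²`). [folklore] -/
theorem abs_mul_exp_le {δ : ℝ} (hδ : 0 < δ) (u : ℝ) : |u| * Real.exp (-(δ / 2) * u ^ 2) ≤ δ ^ (-(1 / 2 : ℝ)) := by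
  have hs : δ * u ^ 2 * Real.exp (-(δ * u ^ 2)) ≤ 1 := by
    rw [Real.exp_neg, mul_inv_le_iff₀ (Real.exp_pos _), one_mul]
    linarith [Real.add_one_le_exp (δ * u ^ 2)]
  have e1 : (|u| * Real.exp (-(δ / 2) * u ^ 2)) ^ 2 = u ^ 2 * Real.exp (-(δ * u ^ 2)) := by
    rw [mul_pow, sq_abs, ← Real.exp_nat_mul]; congr 1; push_cast; ring
  have e2 : (δ ^ (-(1 / 2 : ℝ))) ^ 2 = δ⁻¹ := by
    rw [← Real.rpow_natCast, ← Real.rpow_mul hδ.le]; norm_num; exact Real.rpow_neg_one δ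
  have hsq : (|u| * Real.exp (-(δ / 2) * u ^ 2)) ^ 2 ≤ (δ ^ (-(1 / 2 : ℝ))) ^ 2 := by
    rw [e1, e2]
    calc u ^ 2 * Real.exp (-(δ * u ^ 2)) = δ⁻¹ * (δ * u ^ 2 * Real.exp (-(δ * u ^ 2))) := by
          field_simp
      _ ≤ δ⁻¹ * 1 := mul_le_mul_of_nonneg_left hs (inv_nonneg.2 hδ.le)
      _ = δ⁻¹ := mul_one _
  exact (pow_le_pow_iff_left₀ (by positivity) (Real.rpow_nonneg hδ.le _) two_ne_zero).1 hsq

/-- The linear statistic is bounded by `S ‖v‖`, `S = Σ|c_q|` (sup norm). [folklore] -/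
theorem abs_sum_mul_le (v : ι → Fin D → ℝ) (b : Fin D) : |∑ q, c q * v q b| ≤ (∑ q, |c q|) * ‖v‖ := by
  rw [Finset.sum_mul]
  refine (Finset.abs_sum_le_sum_abs _ _).trans (Finset.sum_le_sum fun q _ => ?_)
  rw [abs_mul]
  exact mul_le_mul_of_nonneg_left (abs_apply_apply_le v q b) (abs_nonneg _)

/-- `|v_{p₀}^b − Σ c_q v_q^b| ≤ (1 + S)‖v‖`. [folklore] -/
theorem abs_sub_sum_mul_le (v : ι → Fin D → ℝ) (b : Fin D) :
    |v p₀ b - ∑ q, c q * v q b| ≤ (1 + ∑ q, |c q|) * ‖v‖ := by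
  have h1 := abs_apply_apply_le v p₀ b
  have h2 := abs_sum_mul_le c v b
  have := abs_sub (v p₀ b) (∑ q, c q * v q b)
  linarith

/-- **Core weight estimate**: with `Q = Σ_b (x_b² + z_b²)`, `t² ≤ Q` and `δ > 0`,
`δ · e^{−(δ/2)Q} · |t| · Σ_b (|x_b| + |z_b|) ≤ D + 1/2` (AM–GM and `u e^{−u/2} ≤ 1`). [folklore] -/
theorem weight_core_le {δ : ℝ} (hδ : 0 < δ) (x z : Fin D → ℝ) (t : ℝ) (ht : t ^ 2 ≤ ∑ b, (x b ^ 2 + z b ^ 2)) :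
    δ * Real.exp (-(δ / 2) * ∑ b, (x b ^ 2 + z b ^ 2)) * |t| * ∑ b, (|x b| + |z b|) ≤ (D : ℝ) + 1 / 2 := by
  set Q : ℝ := ∑ b, (x b ^ 2 + z b ^ 2) with hQ
  have hQ0 : 0 ≤ Q := Finset.sum_nonneg fun b _ => by positivity
  -- `|t| Σ(|x_b|+|z_b|) ≤ D t² + Q/2 ≤ (D + 1/2) Q`
  have hAM : |t| * ∑ b, (|x b| + |z b|) ≤ (D : ℝ) * t ^ 2 + Q / 2 := by
    rw [Finset.mul_sum]
    have hpt : ∀ b, |t| * (|x b| + |z b|) ≤ t ^ 2 + (x b ^ 2 + z b ^ 2) / 2 := fun b => by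
      nlinarith [sq_nonneg (|t| - |x b|), sq_nonneg (|t| - |z b|), sq_abs t, sq_abs (x b), sq_abs (z b),
        abs_nonneg t, abs_nonneg (x b), abs_nonneg (z b)]
    calc ∑ b, |t| * (|x b| + |z b|) ≤ ∑ b, (t ^ 2 + (x b ^ 2 + z b ^ 2) / 2) := Finset.sum_le_sum fun b _ => hpt b
      _ = (D : ℝ) * t ^ 2 + Q / 2 := by
          rw [Finset.sum_add_distrib, Finset.sum_const, Finset.card_univ, Fintype.card_fin, nsmul_eq_mul, hQ,
            ← Finset.sum_div]
  have hB : |t| * ∑ b, (|x b| + |z b|) ≤ ((D : ℝ) + 1 / 2) * Q := by nlinarith [hAM, ht, Nat.cast_nonneg (α := ℝ) D]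
  have hu : δ * Q * Real.exp (-(δ / 2) * Q) ≤ 1 := by
    -- `u e^{-u/2} ≤ 1` for `u = δQ ≥ 0`: `e^{u/2} = (e^{u/4})² ≥ (1 + u/4)² ≥ u`
    have hu0 : 0 ≤ δ * Q := by positivity
    have h1 : δ * Q / 4 + 1 ≤ Real.exp (δ * Q / 4) := Real.add_one_le_exp _
    have h2 : (δ * Q / 4 + 1) ^ 2 ≤ Real.exp (δ * Q / 4) ^ 2 := pow_le_pow_left₀ (by linarith) h1 2
    have h3 : Real.exp (δ * Q / 4) ^ 2 = Real.exp (δ * Q / 2) := by rw [← Real.exp_nat_mul]; congr 1; ring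
    have h4 : δ * Q ≤ Real.exp (δ * Q / 2) := by nlinarith [sq_nonneg (δ * Q / 4 - 1)]
    rw [show -(δ / 2) * Q = -(δ * Q / 2) by ring, Real.exp_neg, mul_inv_le_iff₀ (Real.exp_pos _), one_mul]
    exact h4
  have hE : 0 < Real.exp (-(δ / 2) * Q) := Real.exp_pos _
  calc δ * Real.exp (-(δ / 2) * Q) * |t| * ∑ b, (|x b| + |z b|)
      = δ * Real.exp (-(δ / 2) * Q) * (|t| * ∑ b, (|x b| + |z b|)) := by ring
    _ ≤ δ * Real.exp (-(δ / 2) * Q) * (((D : ℝ) + 1 / 2) * Q) := mul_le_mul_of_nonneg_left hB (by positivity)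
    _ = ((D : ℝ) + 1 / 2) * (δ * Q * Real.exp (-(δ / 2) * Q)) := by ring
    _ ≤ ((D : ℝ) + 1 / 2) * 1 := mul_le_mul_of_nonneg_left hu (by positivity)
    _ = (D : ℝ) + 1 / 2 := mul_one _


end TestFun

end Summit.QuantumFields.YangMills.Cruxes.FreeProbeLawG.SteinFree

end
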